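import Literature.Topology.PlaneTopology.OpenSetArcs
import Literature.Topology.PlaneTopology.Janiszewski
import HarnessLib

/-!
# Crux `SAWDevelopingMap.ObservableToSLE` (stmt-CriticalPhenomena-10472), line `six-class-type-ladder`,
stub T2b′ `stub_carvedReduction_squeeze`: piece (G2″), AN ARC INSIDE A PLANAR DOMAIN DOES NOT
DISCONNECT IT

Landing target:
`Summits/CriticalPhenomena/SAWScalingLimit/Theorems/SAWDevelopingMapObservableToSLETypeLadderCarvedReductionSqueezeArcCut.lean`
(`--supports stmt-CriticalPhenomena-10472`; registered sub-goal `stub_carvedReduction_arcNonSeparating`).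

The super-domain `E` of the moving-carving squeeze is cut out of `D − τ` by cross-cuts running
along the flat gate segments; each cross-cut needs TWO DISJOINT LEGS from the ends of the gate
segment through the (open, connected, carved-cell-free) fat core to the boundary.  The first leg
is a first-hit sub-arc of any arc of the core (`exists_isSimpleArc_of_isOpen`,
`IsSimpleArc.exists_subarc_of_isClosed`); the second leg must avoid the first, and exists because
removing the first leg does not disconnect the core:

* `stub_carvedReduction_arcNonSeparating` — **a simple arc `L` contained in a bounded open
  connected `U ⊆ ℂ` does not separate `U`**: any two points of `U ∖ L` lie in the same connected
  component of `U ∖ L` (Janiszewski's theorem for the disjoint compacta `L` and `B̄(0,R) ∖ U`,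
  together with `IsSimpleArc.isConnected_compl`: an arc does not separate the plane).

Sources: Ch. Pommerenke, Boundary Behaviour of Conformal Maps (1992) §1.1 (Janiszewski);
M. H. A. Newman, Elements of the topology of plane sets of points (1939), Ch. V.
-/

noncomputable section

open Set Metric
open Literature.Topology.PlaneTopology

namespace Summit.CriticalPhenomena.SAWScalingLimit.Theorems.ObservableToSLE.TypeLadder

/-- **Registered sub-goal `stub_carvedReduction_arcNonSeparating`** (crux item stmt-CriticalPhenomena-10472,
stub T2b′ `stub_carvedReduction_squeeze`, piece (G2″) ARCS DO NOT SEPARATE DOMAINS): if `L` is a simple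
arc contained in a bounded open connected set `U ⊆ ℂ`, then any two points `x, y ∈ U ∖ L` lie in the
same connected component of `U ∖ L`. [cite: PommerenkeBBCM1992, §1.1 (Janiszewski's Theorem)] -/
theorem stub_carvedReduction_arcNonSeparating :
    ∀ (U L : Set ℂ) (a b x y : ℂ), IsOpen U → IsConnected U → Bornology.IsBounded U →
      IsSimpleArc L a b → L ⊆ U → x ∈ U \ L → y ∈ U \ L → y ∈ connectedComponentIn (U \ L) x := by
  intro U L a b x y hUo hUc hUb hL hLU hx hy
  -- a large disc containing `U`
  obtain ⟨R, hUR⟩ := hUb.subset_ball (0 : ℂ)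
  set B : Set ℂ := closedBall (0 : ℂ) R ∩ Uᶜ with hB
  have hBc : IsCompact B := (isCompact_closedBall _ _).inter_right hUo.isClosed_compl
  have hLc : IsCompact L := hL.isCompact
  -- `L ∩ B = ∅`
  have hLB : IsPreconnected (L ∩ B) := by
    have : L ∩ B = ∅ := Set.eq_empty_iff_forall_notMem.2 fun z ⟨hzL, hzB⟩ ↦ hzB.2 (hLU hzL)
    rw [this]; exact isPreconnected_empty
  -- `x, y` are separated neither by `L` (an arc does not separate the plane) nor by `B`
  have hyL : y ∈ connectedComponentIn Lᶜ x :=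
    hL.isConnected_compl.isPreconnected.subset_connectedComponentIn hx.2 subset_rfl hy.2
  have hUBc : U ⊆ Bᶜ := fun z hz hzB ↦ hzB.2 hz
  have hyB : y ∈ connectedComponentIn Bᶜ x :=
    hUc.isPreconnected.subset_connectedComponentIn hx.1 hUBc hy.1
  have hJ := janiszewski hLc hBc hLB hyL hyB
  -- the component of `x` in `(L ∪ B)ᶜ = (U ∖ L) ⊔ (far exterior)` stays in `U ∖ L`
  have hcompl : (L ∪ B)ᶜ ⊆ (U \ L) ∪ (closedBall (0 : ℂ) R)ᶜ := by
    intro z hz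
    simp only [mem_compl_iff, mem_union, not_or, hB, mem_inter_iff, not_and] at hz
    by_cases hzR : z ∈ closedBall (0 : ℂ) R
    · exact Or.inl ⟨not_not.1 (hz.2 hzR), hz.1⟩
    · exact Or.inr hzR
  have hdisj : Disjoint (U \ L) (closedBall (0 : ℂ) R)ᶜ :=
    Set.disjoint_left.2 fun z hz hzR ↦ hzR (ball_subset_closedBall (hUR hz.1))
  have hsub : connectedComponentIn (L ∪ B)ᶜ x ⊆ U \ L :=
    isPreconnected_connectedComponentIn.subset_left_of_subset_union (hUo.sdiff hL.isCompact.isClosed)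
      isClosed_closedBall.isOpen_compl hdisj ((connectedComponentIn_subset _ _).trans hcompl)
      ⟨x, mem_connectedComponentIn (show x ∈ (L ∪ B)ᶜ from fun h ↦ h.elim hx.2 (fun hxB ↦ hxB.2 hx.1)), hx⟩
  exact isPreconnected_connectedComponentIn.subset_connectedComponentIn
    (mem_connectedComponentIn (show x ∈ (L ∪ B)ᶜ from fun h ↦ h.elim hx.2 (fun hxB ↦ hxB.2 hx.1)))
    hsub hJ

end Summit.CriticalPhenomena.SAWScalingLimit.Theorems.ObservableToSLE.TypeLadder

end
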